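import Literature.NumberTheory.GaloisRepresentations.LubinTateTowerGenerator
import HarnessLib

/-!
# Relative norms in the Lubin–Tate tower as products over stabilisers

De Shalit, *Iwasawa theory of elliptic curves with complex multiplication* (1987), Ch. I §2.2: the norm
maps `N_{m,n} : k_π^m → k_π^n` of the tower. In the tree the levels `K_π^{n+1} = ltField π n` are
intermediate fields of `F̄/F` and the Coleman files (`LubinTateColemanNormCoherent.lean`,
`LubinTateColemanInterpolation.lean`) write the relative norm of `x ∈ K_π^{m+1}` down to `K_π^{n+1}` as the
product of `σ x` over the STABILISER `{σ ∈ Gal(K_π^{m+1}/F) : σ ω_{n+1} = ω_{n+1}}` of the generator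
`ω_{n+1} = cohPt hπ n`. This file identifies that product with Mathlib's `Algebra.norm` for the tower algebra
`K_π^{n+1} → K_π^{m+1}` (everything **proved**), so that norm-coherent sequences in the usual sense
(`Algebra.norm_norm` transitivity etc.) feed the interpolation theorem:

* `towerAlgebra h` — `E₂` as an `E₁`-algebra for `E₁ ≤ E₂ ⊆ F̄` (the inclusion), a scalar tower over `F`,
  finite and Galois when `E₂/F` is.
* `algebraMap_towerNorm_eq_prod` — **`ι(N_{E₂/E₁} x) = ∏_{σ ∈ Gal(E₂/F), σ|_{E₁} = id} σ x`**
  (`Algebra.norm_eq_prod_automorphisms` for `E₂/E₁`, re-indexed along `AlgEquiv.restrictScalars F`).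
* `forall_apply_inclusion_eq_iff` — an automorphism fixes `K_π^{n+1}` pointwise iff it fixes `ω_{n+1}`;
  hence ★ `algebraMap_towerNorm_ltField_eq_prod_stabilizer` — **the relative norm `K_π^{m+1} → K_π^{n+1}` IS the
  stabiliser product** used in the Coleman files.

## References

* E. de Shalit, *Iwasawa theory of elliptic curves with complex multiplication* (1987), Ch. I §2.2 (the
  norms `N_{m,n}`). [cite: deShalit1987, Ch. I §2.2]
* J.-P. Serre, *Local Fields* (1979), Ch. II §2.

## Mathlib reuse

`Algebra.norm_eq_prod_automorphisms`, `IsGalois.tower_top_of_isGalois`, `FiniteDimensional.right`,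
`AlgEquiv.restrictScalars`, `Finset.prod_bij`, `PowerBasis.algHom_ext`, `IntermediateField.adjoin.powerBasis`;
from the tree: `LubinTateTowerGenerator.lean` (`cohPt`, `inclPt_ltAct_of_le`), `LubinTateCharacter.lean`
(`ltAct`, `mapPt_ltAct'`), `LubinTateCharacterLimit.lean` (`inclPt`, `ltField_mono`), `LubinTateTorsion.lean`
(`mapPt`, `isGalois_ltField`).
-/

noncomputable section

open Polynomial

namespace Literature.NumberTheory.GaloisRepresentations

section Concrete

open ValuativeRel GaloisRepresentations.IsNonarchimedeanLocalField LubinTate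

variable {F : Type*} [Field F] [ValuativeRel F] [TopologicalSpace F] [IsNonarchimedeanLocalField F]

attribute [local instance] instUniformSpace_literature rk1 nF nE ltCharIsUniformAddGroup

/-! ### The tower algebra `E₁ → E₂` and its norm -/

section Tower

variable {E₁ E₂ : IntermediateField F (AlgebraicClosure F)}

omit [ValuativeRel F] [TopologicalSpace F] [IsNonarchimedeanLocalField F] in
/-- `E₂` as an algebra over `E₁ ≤ E₂` (the inclusion). [cite: deShalit1987, Ch. I §2.2] -/
abbrev towerAlgebra (h : E₁ ≤ E₂) : Algebra E₁ E₂ := (IntermediateField.inclusion h).toRingHom.toAlgebra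

omit [ValuativeRel F] [TopologicalSpace F] [IsNonarchimedeanLocalField F] in
/-- The structure map of `towerAlgebra h` is the inclusion (unfolding). [cite: deShalit1987, Ch. I §2.2] -/
theorem towerAlgebra_algebraMap_apply (h : E₁ ≤ E₂) (y : E₁) :
    @algebraMap E₁ E₂ _ _ (towerAlgebra h) y = IntermediateField.inclusion h y := rfl

omit [ValuativeRel F] [TopologicalSpace F] [IsNonarchimedeanLocalField F] in
/-- `F → E₁ → E₂` is a scalar tower. [cite: deShalit1987, Ch. I §2.2] -/
theorem towerAlgebra_isScalarTower (h : E₁ ≤ E₂) :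
    @IsScalarTower F E₁ E₂ _ (towerAlgebra h).toSMul _ := by
  letI := towerAlgebra h
  refine IsScalarTower.of_algebraMap_eq fun r => ?_
  rw [towerAlgebra_algebraMap_apply, AlgHom.commutes]

omit [ValuativeRel F] [TopologicalSpace F] [IsNonarchimedeanLocalField F] in
/-- **The relative norm as a product over the automorphisms fixing `E₁`**: for `E₂/F` finite Galois and
`E₁ ≤ E₂`, `ι(N_{E₂/E₁} x) = ∏_{σ ∈ Gal(E₂/F), σ|_{E₁} = id} σ x`. [cite: deShalit1987, Ch. I §2.2] -/
theorem algebraMap_towerNorm_eq_prod [FiniteDimensional F E₂] [IsGalois F E₂] (h : E₁ ≤ E₂) (x : E₂) :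
    open scoped Classical in
    IntermediateField.inclusion h (@Algebra.norm E₁ E₂ _ _ (towerAlgebra h) x) =
      ∏ σ ∈ Finset.univ.filter (fun σ : E₂ ≃ₐ[F] E₂ =>
        ∀ y : E₁, σ (IntermediateField.inclusion h y) = IntermediateField.inclusion h y), σ x := by
  classical
  letI := towerAlgebra h
  haveI := towerAlgebra_isScalarTower h
  haveI : FiniteDimensional E₁ E₂ := FiniteDimensional.right F E₁ E₂
  haveI : IsGalois E₁ E₂ := IsGalois.tower_top_of_isGalois F E₁ E₂
  have h1 : IntermediateField.inclusion h (Algebra.norm E₁ x) = algebraMap E₁ E₂ (Algebra.norm E₁ x) := rfl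
  rw [h1, Algebra.norm_eq_prod_automorphisms]
  -- reindex along `τ ↦ τ.restrictScalars F`
  refine Finset.prod_bij (fun τ _ => AlgEquiv.restrictScalars F τ) (fun τ _ => ?_)
    (fun τ₁ _ τ₂ _ h12 => AlgEquiv.restrictScalars_injective F h12) (fun σ hσ => ?_) (fun τ _ => rfl)
  · rw [Finset.mem_filter]
    exact ⟨Finset.mem_univ _, fun y => τ.commutes y⟩
  · rw [Finset.mem_filter] at hσ
    refine ⟨{ σ with commutes' := fun y => hσ.2 y }, Finset.mem_univ _, ?_⟩
    ext z
    rfl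

end Tower

/-! ### The levels of the Lubin–Tate tower: fixing `K_π^{n+1}` = fixing `ω_{n+1}` -/

variable {π : 𝒪[F]} (hπ : (valuation F).IsUniformizer (π : F))

/-- An `F`-automorphism of `E₂ ⊇ K_π^{n+1}` fixes `K_π^{n+1} = F(λ_{n+1})` pointwise iff it fixes `λ_{n+1}`.
[cite: deShalit1987, Ch. I §1.8] -/
theorem forall_apply_inclusion_eq_iff_gen {n : ℕ} {E₂ : IntermediateField F (AlgebraicClosure F)}
    (h : ltField π n ≤ E₂) (σ : E₂ ≃ₐ[F] E₂) :
    (∀ y : ltField π n, σ (IntermediateField.inclusion h y) = IntermediateField.inclusion h y) ↔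
      σ (IntermediateField.inclusion h (IntermediateField.AdjoinSimple.gen F (ltRoot π n))) =
        IntermediateField.inclusion h (IntermediateField.AdjoinSimple.gen F (ltRoot π n)) := by
  refine ⟨fun H => H _, fun H y => ?_⟩
  have hint := isIntegral_ltRoot π n
  set pb := IntermediateField.adjoin.powerBasis hint
  have key : (σ : E₂ →ₐ[F] E₂).comp (IntermediateField.inclusion h) = IntermediateField.inclusion h := by
    refine pb.algHom_ext ?_
    rw [IntermediateField.adjoin.powerBasis_gen hint, AlgHom.comp_apply]
    exact H
  exact congrArg (fun φ : ltField π n →ₐ[F] E₂ => φ y) key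

/-- In `K_π^{m+1}`, an automorphism fixes the image of `K_π^{n+1}` pointwise iff it fixes the generator
`ω_{n+1} = [u_n] λ_{n+1}` (`σ` commutes with `[u_n]_f`, `[u_n⁻¹]_f`). [cite: deShalit1987, Ch. I §2.2] -/
theorem forall_apply_inclusion_eq_iff_mapPt_cohPt {n m : ℕ} (hnm : n ≤ m)
    (σ : ltField π m ≃ₐ[F] ltField π m) :
    (∀ y : ltField π n, σ (IntermediateField.inclusion (ltField_mono hπ hnm) y) =
        IntermediateField.inclusion (ltField_mono hπ hnm) y) ↔
      mapPt σ (inclPt (ltField_mono hπ hnm) (cohPt hπ n)) = inclPt (ltField_mono hπ hnm) (cohPt hπ n) := by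
  rw [forall_apply_inclusion_eq_iff_gen]
  have hgen : inclPt (ltField_mono hπ hnm) (genPt hπ n) =
      ltAct hπ m ((cohUnit hπ n)⁻¹ : 𝒪[F]ˣ) (inclPt (ltField_mono hπ hnm) (cohPt hπ n)) := by
    rw [cohPt_eq, inclPt_ltAct_of_le hπ, ← ltAct_mul, Units.inv_mul, ltAct_one]
  have hcoh : inclPt (ltField_mono hπ hnm) (cohPt hπ n) =
      ltAct hπ m (cohUnit hπ n : 𝒪[F]) (inclPt (ltField_mono hπ hnm) (genPt hπ n)) := by
    rw [cohPt_eq, inclPt_ltAct_of_le hπ]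
  constructor
  · intro H
    have H' : mapPt σ (inclPt (ltField_mono hπ hnm) (genPt hπ n)) = inclPt (ltField_mono hπ hnm) (genPt hπ n) :=
      pt_ext (congrArg (fun z : ltField π m => (z : AlgebraicClosure F)) H)
    rw [hcoh, mapPt_ltAct', H']
  · intro H
    have H' : mapPt σ (inclPt (ltField_mono hπ hnm) (genPt hπ n)) = inclPt (ltField_mono hπ hnm) (genPt hπ n) := by
      rw [hgen, mapPt_ltAct', H]
    exact congrArg (fun z : (maxNilIdeal F (ltField π m)).toIdeal => ((z : unitBall (ltField π m)) : ltField π m)) H'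

/-- ★ **The relative norm `K_π^{m+1} → K_π^{n+1}` is the product over the stabiliser of `ω_{n+1}`**:
`ι(N_{K_π^{m+1}/K_π^{n+1}} x) = ∏_{σ ∈ Gal(K_π^{m+1}/F), σ ω_{n+1} = ω_{n+1}} σ x` — the form of
norm-coherence used in `LubinTateColemanInterpolation.lean`. [cite: deShalit1987, Ch. I §2.2] -/
theorem algebraMap_towerNorm_ltField_eq_prod_stabilizer {n m : ℕ} (hnm : n ≤ m) (x : ltField π m) :
    open scoped Classical in
    IntermediateField.inclusion (ltField_mono hπ hnm)
        (@Algebra.norm (ltField π n) (ltField π m) _ _ (towerAlgebra (ltField_mono hπ hnm)) x) =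
      ∏ σ ∈ Finset.univ.filter (fun σ : ltField π m ≃ₐ[F] ltField π m =>
        mapPt σ (inclPt (ltField_mono hπ hnm) (cohPt hπ n)) = inclPt (ltField_mono hπ hnm) (cohPt hπ n)), σ x := by
  classical
  haveI := isGalois_ltField hπ m
  rw [algebraMap_towerNorm_eq_prod]
  exact Finset.prod_congr (Finset.filter_congr fun σ _ => forall_apply_inclusion_eq_iff_mapPt_cohPt hπ hnm σ)
    fun _ _ => rfl

end Concrete

end Literature.NumberTheory.GaloisRepresentations
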